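import Summits.QuantumFields.YangMills.Theorems.BalabanUVNodesN15KingModelMinimizer

/-!
# BalabanUVNodes ∕ N15 — THE KING-MODEL RUNG, PART 4: `NE2PlusSite` FOR THE H-KERNEL (King's minimiser `ℋ_K` and `∂^η_μℋ_K`),
# HYPOTHESIS-FREE, and the node shape `N15At` at the King-model carriers whose SITE layer is the H-kernel
# (Track A, DAG node N15 = NE2; FAN-OUT v1.1 §N15 s3 «KING-MODEL ∕ RIEMANN-KERNEL RUNG», door (iii); the layer∕node half of part 3)

HONEST FRAMING.  Count-neutral kernel bookkeeping (cell `pub-ymgap`, seat `pub-ymgap-dag-n15-e` g2; `--supports stmt-QuantumFields-19676`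
= K3 `SpineGivenEndpointR11`).  King's `A = 0` SCALAR MODEL ([King1986], template literature, printed AND proved) — NOT Bałaban's covariant
minimiser `H_k(U)` of [Balaban1985BackgroundPropagators] Sect. D, for which NE2⁺ is NOT PRINTED and not proved; NOT a node discharge; finite
tori; nothing continuum ∕ ℝ⁴ ∕ OS ∕ mass-gap ∕ Clay.  0 `sorry`, standard axioms; one plumbing `def` (a carrier bundle).

THE POINT (continuing part 3 `…N15KingModelMinimizer`, which has the objects, Theorem 3.3's majorants and the uniform step bounds
`kingHStep_le` ∕ `dkingHStep_le` — (3.71) lines 1–2 BY NAME from `King1986.Torus.king_prop38_torus_blocks` ∕ `king_prop38_deriv_torus_blocks`).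
* §4 THE LAYER: `etaRateIneqSite_kingH` ∕ `etaRateIneqSite_dkingH`, **`ne2PlusSite_kingH`** ∕ `ne2ZeroSite_kingH` (`0 < γ ≤ 1`),
  **`ne2PlusSite_dkingH`** ∕ `ne2ZeroSite_dkingH` (`0 < γ < 1`, the derivative line's alias exponent) — `NE2PlusSite d′ p c35` on part 1's
  `kingVolInstance d L` for the H-kernel's SUP-OVER-THE-BLOCK η-difference entries `kingHSite` ∕ `dkingHSite`, HYPOTHESIS-FREE, every exponent
  pair (all sites have size `L^Kη = 1`; the honest [B9] exponents of (3.133)'s sup entries are `p = 0` for `ℋ`, `p = 1` for `∂ℋ`), guards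
  `M₅ = a₀ = 1`, `δ > 0`, rate `γ∕2` (`0 < L^{−γ∕2} < 1`: part 1's `topPiece_rate_mem_Ioo`); and `ne2PlusSite_kingH_iff_zero` (part 2 §3's generic `ne2PlusSite_iff_ne2ZeroSite`: on one-point
  backgrounds NE2⁺ ⟺ NE2⁰).
* §5 THE NODE SHAPE WITH THE HONEST SITE OBJECT: **`n15_kingModelRungH`** = `NE2PlusOperator (topPieceOp) ∧ NE2PlusSite d′ p (kingHSite) ∧
  NE2PlusUnit (blockCovUnit)` on ONE family, hypothesis-free; `kingVolCarriersH : NE2Carriers` (`d + 1 = 4`) and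
  **`n15At_kingModelRungH : N15At (kingVolCarriersH …)`** — the K4 by-name statement with operator layer = King's propagator piece
  `G^η_{(K)}` (part 1, Prop. 3.9), SITE layer = King's H-kernel `ℋ_K = a_KG_KQ_K^*` (Prop. 3.8), unit layer = King's block-field covariance
  `(Δ^{(K)})⁻¹` (part 2, (4.41)): the three [B9] object CLASSES of `T4EtaRate` §(4) (propagators ∕ `𝔅`-kernels incl. the H-kernel (3.133) ∕
  `C^{(k)}(Λ)`) each read on King's object of the same class.
WHAT THE CURVED CASE ADDS (H-layer, one line): Bałaban's NE2⁺ site layer asks this inequality for the `U`-DEPENDENT minimiser `H_k(U)` of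
[B9] Sect. D on the multiscale `𝔅 = ⋃_j Λ_j` with the `(L^jη)^{−p}(L^{j′}η)^{−d}` prefactors of (3.133), UNIFORMLY over the live window
`Reg335 c35 α₀ U` ((3.35)); in print the background control is analyticity in `U` (Thm 3.4, tree `B9.Thm34Printed`) and uniformity in `η`,
never an η-difference (`T4EtaRate` header, GAPS G-t4-U1a-1); on the model's one-point background sort NE2⁺ ⟺ NE2⁰ (§4).
HONEST SCOPE (as part 3).  (i) `A = 0`: every `NE2Plus…` conclusion quantifies its background over `{U ≡ 1}`; (ii) single top scale (one-scale
tower; sources are unit sites, observations are read over whole unit blocks of the finest lattice — no base-point collapse); (iii) objects =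
King's scalar `ℋ_K` on Bałaban's volumes `2L^m`, odd `L ≥ 3`; the Hölder-quotient lines 3–4 of (3.71) ([B9]'s (3.43)–(3.45), untyped in
`T4EtaRate`) are not read.  Locators: [King1986] C. King, CMP **102** (1986) 649–677: (2.13)–(2.15) p. 653, Prop. 3.8 (3.71) p. 664, Prop. 3.9
(3.73) p. 665, (4.41)∕(4.44) p. 675; [B9] = [Balaban1985BackgroundPropagators] CMP **99** (1985): (3.35) p. 396, Thm 3.1 (3.42) p. 397, Thm 3.2
(3.48) p. 398, Thm 3.4 p. 400, (3.133) p. 422, Thm 3.14 pp. 426–427 (typing template), Thm 3.15 (3.187) p. 432.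
-/

noncomputable section

namespace Summit.QuantumFields.YangMills.BalabanUVNodes.N15KingModelRung

open Real Finset
open Literature.MathematicalPhysics.QuantumFieldTheory.Balaban1983to89
open Literature.MathematicalPhysics.QuantumFieldTheory.Balaban1983to89.T4EtaRate (PairedInstance EtaRateIneqSite NE2PlusOperator
  NE2PlusSite NE2PlusUnit rateFactor)
open Literature.MathematicalPhysics.QuantumFieldTheory.Balaban1983to89.T4EtaRateSiteOfRatePair (NE2ZeroSite)
open Literature.MathematicalPhysics.QuantumFieldTheory.Balaban1983to89.T4EtaRateOperatorTorus (torusOpGeo torusOpInstance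
  torusOpGeo_len torusOpGeo_dist rateFactor_torusOpGeo)
open Literature.MathematicalPhysics.QuantumFieldTheory.Balaban1983to89.B5Prop11Plancherel (Tor fine)
open Literature.MathematicalPhysics.QuantumFieldTheory.King1986.Torus (tdistT)
open YMDAG.UVSplit (NE2Carriers N15At)

variable {d : ℕ}


/-! ## §4 The layer: `NE2PlusSite` ∕ `NE2ZeroSite` for the H-kernel and its derivative, hypothesis-free -/

section Layers

variable (L : ℕ) [NeZero L]

/-- **THE TYPED SITE INEQUALITY FOR THE H-KERNEL, UNIFORMLY** (odd `L ≥ 3`, `a, m² > 0`, `0 < γ ≤ 1`): ONE `(C, δ)` such that for EVERY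
index and (the unique) background, `EtaRateIneqSite d′ p (kingHSite L a m² j) C δ (γ∕2)` — every exponent pair `(d′, p)` (all sites have
size `L^Kη = 1`; the honest [B9] exponent of the H-kernel's sup entry is `p = 0`). [cite: Balaban1985BackgroundPropagators, (3.133) p.422 (shape) + Thm 3.14 pp.426–427 (template); King1986, Prop. 3.8 (3.71) p.664] -/
theorem etaRateIneqSite_kingH (hLodd : Odd L) (hL : 2 ≤ L) {a m2 : ℝ} (ha : 0 < a) (hm : 0 < m2) {γ : ℝ} (hγ0 : 0 < γ)
    (hγ1 : γ ≤ 1) :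
    ∃ C δ : ℝ, 0 < C ∧ 0 < δ ∧ ∀ (j : KingVolIndex d) (U : (kingVolInstance d L j).Bf.Cfg) (d' : ℕ) (p : ℝ),
      EtaRateIneqSite d' p (kingHSite L a m2 j) C δ (γ / 2) U := by
  obtain ⟨C, δ, hC, hδ, H⟩ := kingHStep_le (d := d) L hLodd hL ha hm hγ0.le hγ1
  refine ⟨C, δ, hC, hδ, fun j U d' p y y' => ?_⟩
  haveI := kingVol_neZero L j
  have hL0 : (0 : ℝ) < L := by exact_mod_cast Nat.pos_of_ne_zero (NeZero.ne L)
  show |kingHStep L a m2 j y y'| ≤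
    C * (torusOpGeo d (L : ℝ) j.Msz j.K (kingVol L j)).len y ^ (-p) *
      (torusOpGeo d (L : ℝ) j.Msz j.K (kingVol L j)).len y' ^ (-(d' : ℝ)) *
      Real.exp (-(δ * (torusOpGeo d (L : ℝ) j.Msz j.K (kingVol L j)).dist y y')) *
      max (rateFactor (torusOpGeo d (L : ℝ) j.Msz j.K (kingVol L j)) (γ / 2) y)
        (rateFactor (torusOpGeo d (L : ℝ) j.Msz j.K (kingVol L j)) (γ / 2) y')
  rw [torusOpGeo_len _ hL0.ne', torusOpGeo_len _ hL0.ne', Real.one_rpow, Real.one_rpow, mul_one, mul_one,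
    rateFactor_torusOpGeo _ hL0, rateFactor_torusOpGeo _ hL0, max_self, torusOpGeo_dist, ← tdistT_eq_dist,
    abs_of_nonneg (kingHStep_nonneg L a m2 j y y')]
  exact H j y y'

/-- **THE TYPED SITE INEQUALITY FOR THE DERIVATIVE OF THE H-KERNEL, UNIFORMLY** (`0 < γ < 1`; honest exponent `p = 1`). [cite: Balaban1985BackgroundPropagators, (3.133) p.422 (shape) + Thm 3.14 pp.426–427 (template); King1986, Prop. 3.8 (3.71) p.664 (second line)] -/
theorem etaRateIneqSite_dkingH (hLodd : Odd L) (hL : 2 ≤ L) {a m2 : ℝ} (ha : 0 < a) (hm : 0 < m2) {γ : ℝ} (hγ0 : 0 < γ)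
    (hγ1 : γ < 1) :
    ∃ C δ : ℝ, 0 < C ∧ 0 < δ ∧ ∀ (j : KingVolIndex d) (U : (kingVolInstance d L j).Bf.Cfg) (d' : ℕ) (p : ℝ),
      EtaRateIneqSite d' p (dkingHSite L a m2 j) C δ (γ / 2) U := by
  obtain ⟨C, δ, hC, hδ, H⟩ := dkingHStep_le (d := d) L hLodd hL ha hm hγ0.le hγ1
  refine ⟨C, δ, hC, hδ, fun j U d' p y y' => ?_⟩
  haveI := kingVol_neZero L j
  have hL0 : (0 : ℝ) < L := by exact_mod_cast Nat.pos_of_ne_zero (NeZero.ne L)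
  show |dkingHStep L a m2 j y y'| ≤
    C * (torusOpGeo d (L : ℝ) j.Msz j.K (kingVol L j)).len y ^ (-p) *
      (torusOpGeo d (L : ℝ) j.Msz j.K (kingVol L j)).len y' ^ (-(d' : ℝ)) *
      Real.exp (-(δ * (torusOpGeo d (L : ℝ) j.Msz j.K (kingVol L j)).dist y y')) *
      max (rateFactor (torusOpGeo d (L : ℝ) j.Msz j.K (kingVol L j)) (γ / 2) y)
        (rateFactor (torusOpGeo d (L : ℝ) j.Msz j.K (kingVol L j)) (γ / 2) y')
  rw [torusOpGeo_len _ hL0.ne', torusOpGeo_len _ hL0.ne', Real.one_rpow, Real.one_rpow, mul_one, mul_one,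
    rateFactor_torusOpGeo _ hL0, rateFactor_torusOpGeo _ hL0, max_self, torusOpGeo_dist, ← tdistT_eq_dist,
    abs_of_nonneg (dkingHStep_nonneg L a m2 j y y')]
  exact H j y y'

/-- **`NE2PlusSite` IS INHABITED BY KING'S H-KERNEL ON THE KING-MODEL FAMILY, HYPOTHESIS-FREE** (odd `L ≥ 3`, `a, m² > 0`,
`0 < γ ≤ 1`; every `d′`, `p`, `c35`): constants `(M₅, δ, a₀, C, γ′) = (1, δ, 1, C, γ∕2)`, uniform in `(m, K, Msz)`.  HONEST SCOPE (i)–(iii).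
[cite: Balaban1985BackgroundPropagators, (3.133) p.422 + Thm 3.2 (3.48) p.398 + Thm 3.14 pp.426–427 (quantifier template); King1986, Prop. 3.8 (3.71) p.664] -/
theorem ne2PlusSite_kingH (hLodd : Odd L) (hL : 2 ≤ L) {a m2 : ℝ} (ha : 0 < a) (hm : 0 < m2) {γ : ℝ} (hγ0 : 0 < γ)
    (hγ1 : γ ≤ 1) (d' : ℕ) (p c35 : ℝ) :
    NE2PlusSite d' p c35 (kingVolInstance d L) (kingHSite L a m2) := by
  obtain ⟨C, δ, hC, hδ, H⟩ := etaRateIneqSite_kingH (d := d) L hLodd hL ha hm hγ0 hγ1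
  exact ⟨1, δ, 1, C, γ / 2, one_pos, hδ, one_pos, hC, half_pos hγ0, fun j _ _ _ _ U _ => H j U d' p⟩

/-- **`NE2ZeroSite` HOLDS FOR KING'S H-KERNEL** (same data). [cite: King1986, Prop. 3.8 (3.71) p.664 (A = 0 model)] -/
theorem ne2ZeroSite_kingH (hLodd : Odd L) (hL : 2 ≤ L) {a m2 : ℝ} (ha : 0 < a) (hm : 0 < m2) {γ : ℝ} (hγ0 : 0 < γ)
    (hγ1 : γ ≤ 1) (d' : ℕ) (p : ℝ) :
    NE2ZeroSite d' p (kingVolInstance d L) (kingHSite L a m2) := by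
  obtain ⟨C, δ, hC, hδ, H⟩ := etaRateIneqSite_kingH (d := d) L hLodd hL ha hm hγ0 hγ1
  exact ⟨1, δ, C, γ / 2, one_pos, hδ, hC, half_pos hγ0, fun j _ => H j _ d' p⟩

/-- **`NE2PlusSite` IS INHABITED BY THE DERIVATIVE OF KING'S H-KERNEL, HYPOTHESIS-FREE** (`0 < γ < 1`; every `d′`, `p`, `c35`).
[cite: Balaban1985BackgroundPropagators, (3.133) p.422 + Thm 3.14 pp.426–427 (quantifier template); King1986, Prop. 3.8 (3.71) p.664 (second line)] -/
theorem ne2PlusSite_dkingH (hLodd : Odd L) (hL : 2 ≤ L) {a m2 : ℝ} (ha : 0 < a) (hm : 0 < m2) {γ : ℝ} (hγ0 : 0 < γ)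
    (hγ1 : γ < 1) (d' : ℕ) (p c35 : ℝ) :
    NE2PlusSite d' p c35 (kingVolInstance d L) (dkingHSite L a m2) := by
  obtain ⟨C, δ, hC, hδ, H⟩ := etaRateIneqSite_dkingH (d := d) L hLodd hL ha hm hγ0 hγ1
  exact ⟨1, δ, 1, C, γ / 2, one_pos, hδ, one_pos, hC, half_pos hγ0, fun j _ _ _ _ U _ => H j U d' p⟩

/-- **`NE2ZeroSite` HOLDS FOR THE DERIVATIVE OF KING'S H-KERNEL** (same data). [cite: King1986, Prop. 3.8 (3.71) p.664 (second line, A = 0 model)] -/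
theorem ne2ZeroSite_dkingH (hLodd : Odd L) (hL : 2 ≤ L) {a m2 : ℝ} (ha : 0 < a) (hm : 0 < m2) {γ : ℝ} (hγ0 : 0 < γ)
    (hγ1 : γ < 1) (d' : ℕ) (p : ℝ) :
    NE2ZeroSite d' p (kingVolInstance d L) (dkingHSite L a m2) := by
  obtain ⟨C, δ, hC, hδ, H⟩ := etaRateIneqSite_dkingH (d := d) L hLodd hL ha hm hγ0 hγ1
  exact ⟨1, δ, C, γ / 2, one_pos, hδ, hC, half_pos hγ0, fun j _ => H j _ d' p⟩

/-- WHAT THE CURVED CASE ADDS, at this layer: on the King-model family (one-point backgrounds, (3.35) reads `True`) the H-kernel's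
`NE2PlusSite` IS its `NE2ZeroSite` (part 2's generic `ne2PlusSite_iff_ne2ZeroSite`) — Bałaban's `H_k(U)` adds exactly the live
quantifier `∀ U, Reg335 c35 α₀ U → …`. [cite: Balaban1985BackgroundPropagators, (3.35) p.396, (3.133) p.422, Thm 3.4 p.400] [folklore] -/
theorem ne2PlusSite_kingH_iff_zero (a m2 c35 : ℝ) (d' : ℕ) (p : ℝ) :
    (NE2PlusSite d' p c35 (kingVolInstance d L) (kingHSite L a m2) ↔ NE2ZeroSite d' p (kingVolInstance d L) (kingHSite L a m2)) ∧
      (NE2PlusSite d' p c35 (kingVolInstance d L) (dkingHSite L a m2) ↔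
        NE2ZeroSite d' p (kingVolInstance d L) (dkingHSite L a m2)) :=
  ⟨ne2PlusSite_iff_ne2ZeroSite d' p c35 (fun _ => instSubsingletonPUnit) (fun _ _ _ => trivial),
    ne2PlusSite_iff_ne2ZeroSite d' p c35 (fun _ => instSubsingletonPUnit) (fun _ _ _ => trivial)⟩

end Layers

/-! ## §5 The node shape with the honest site object: King's propagator piece, King's H-kernel, King's block-field covariance -/

section Node

variable (L : ℕ) [NeZero L]

/-- **NE2 IN KING'S MODEL WITH THE H-KERNEL AS SITE LAYER — THE THREE LAYERS ON ONE FAMILY, HYPOTHESIS-FREE** (odd `L ≥ 3`,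
`a, m² > 0`, `0 < γ ≤ 1`; every `d′`, `p`, `c35`): on `kingVolInstance d L`, `NE2PlusOperator` for the propagator top piece `G^η_{(K)}`
(part 1, Prop. 3.9) ∧ `NE2PlusSite d′ p` for the H-KERNEL `ℋ_K = a_KG_KQ_K^*` (§4, Prop. 3.8) ∧ `NE2PlusUnit` for the block-field covariance
`(Δ^{(K)})⁻¹` (part 2, (4.41)) — each [B9] object class of `T4EtaRate` §(4) read on King's object of the same class.  HONEST SCOPE (i)–(iii);
NOT Bałaban's objects, NOT a node discharge. [cite: King1986, Prop. 3.8 (3.71) p.664, Prop. 3.9 (3.73) p.665, p.675, (4.41) p.675; Balaban1985BackgroundPropagators, Thm 3.1 p.397 + (3.133) p.422 + Thm 3.15 (3.187) p.432 (quantifier templates)] -/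
theorem n15_kingModelRungH (hLodd : Odd L) (hL : 2 ≤ L) {a m2 : ℝ} (ha : 0 < a) (hm : 0 < m2) {γ : ℝ} (hγ0 : 0 < γ)
    (hγ1 : γ ≤ 1) (d' : ℕ) (p c35 : ℝ) :
    NE2PlusOperator c35 (kingVolInstance d L) (topPieceOp L a m2) ∧
      NE2PlusSite d' p c35 (kingVolInstance d L) (kingHSite L a m2) ∧
      NE2PlusUnit c35 (kingVolInstance d L) (blockCovUnit L a m2) (fun _ _ => True) (kingUnitDist L) :=
  ⟨ne2PlusOperator_topPiece L hLodd hL ha hm hγ0 hγ1 c35, ne2PlusSite_kingH L hLodd hL ha hm hγ0 hγ1 d' p c35,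
    ne2PlusUnit_blockCov L hL ha hm c35⟩

/-- THE KING-MODEL CARRIER BUNDLE WITH THE H-KERNEL AS SITE LAYER (`YMDAG.UVSplit.NE2Carriers`, `d + 1 = 4`): index `KingVolIndex 3`,
paired instances `kingVolInstance 3 L`, operator family = the top piece (part 1), **site kernels = King's H-kernel `kingHSite`**, unit kernels
= the block-field covariance (part 2), `inΛ := True`, `unitDist := tdistT`.  NOT the carriers of record (NODE 00's); no `RRec` instantiated.
[cite: King1986, (2.13)–(2.17) p.653, Prop. 3.8 p.664, (4.41) and (4.44) p.675 (objects)] -/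
def kingVolCarriersH (a m2 c35 p : ℝ) : NE2Carriers where
  I := KingVolIndex 3
  c35 := c35
  p := p
  pi := kingVolInstance 3 L
  Kop := topPieceOp L a m2
  Ksite := kingHSite L a m2
  Kunit := blockCovUnit L a m2
  inΛ := fun _ _ => True
  unitDist := kingUnitDist L

/-- **«NE2_in_KingModel», H-KERNEL EDITION: THE K4 BY-NAME STATEMENT `N15At` HOLDS AT THE KING-MODEL CARRIERS WHOSE SITE LAYER IS
KING'S MINIMISER, HYPOTHESIS-FREE** (odd `L ≥ 3`, `a, m² > 0`, `0 < γ ≤ 1`, every `c35`, `p`; `d + 1 = 4`).  NOT `S_N15 RRec`, NOT a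
discharge. [cite: King1986, Prop. 3.8 (3.71) p.664, Prop. 3.9 (3.73) p.665, p.675, (4.41) p.675; Balaban1985BackgroundPropagators, Thm 3.1 p.397 + (3.133) p.422 + Thm 3.15 (3.187) p.432 (quantifier templates)] -/
theorem n15At_kingModelRungH (hLodd : Odd L) (hL : 2 ≤ L) {a m2 : ℝ} (ha : 0 < a) (hm : 0 < m2) {γ : ℝ} (hγ0 : 0 < γ)
    (hγ1 : γ ≤ 1) (c35 p : ℝ) : N15At (kingVolCarriersH L a m2 c35 p) :=
  n15_kingModelRungH (d := 3) L hLodd hL ha hm hγ0 hγ1 4 p c35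

/-- The bundle's index type is inhabited (not the empty-index trap). [folklore] -/
theorem kingVolCarriersH_index_nonempty (a m2 c35 p : ℝ) : Nonempty (kingVolCarriersH L a m2 c35 p).I :=
  kingVolIndex_nonempty 3

end Node

end Summit.QuantumFields.YangMills.BalabanUVNodes.N15KingModelRung

end
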